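import Literature.RingTheory.KTheory.MilnorPatching
import Mathlib.RingTheory.Smooth.Fiber
import Mathlib.RingTheory.Smooth.Flat
import Mathlib.RingTheory.Kaehler.TensorProduct
import Mathlib.RingTheory.Finiteness.ModuleFinitePresentation
import Mathlib.RingTheory.Finiteness.Nakayama
import Mathlib.LinearAlgebra.TensorProduct.Quotient
import Mathlib.RingTheory.Flat.EquationalCriterion
import HarnessLib

/-!
# Finite étale algebras patch over a Milnor square

Topic `Literature/RingTheory/Etale`. Let `A → A₁, A → A₂, A₁ ↠ A', A₂ → A'` be a Milnor square of
commutative rings (`Literature.RingTheory.KTheory.IsMilnorSquare`: `A = A₁ ×_{A'} A₂` and `A₁ → A'`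
surjective — e.g. the conductor square `A ⊂ Ã, A/𝔠, Ã/𝔠` of a finite birational extension, or
`A/(I ∩ J) = A/I ×_{A/(I+J)} A/J`). Given an `A₁`-algebra `B₁`, an `A₂`-algebra `B₂` and an
`A'`-ALGEBRA isomorphism `θ : A' ⊗_{A₂} B₂ ≅ A' ⊗_{A₁} B₁`, Milnor's module `M(B₁, B₂, θ)` is a
subalgebra `B = B₁ ×_θ B₂ ⊆ B₁ × B₂` (`patchAlgebra`), and:

* if `B₁`, `B₂` are finite projective then so is `B`, with `A₁ ⊗_A B ≅ B₁`, `A₂ ⊗_A B ≅ B₂` through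
  the projections (`finite_patchAlgebra`, `projective_patchAlgebra`, `isBaseChange_patchFstHom`,
  `isBaseChange_patchSndHom`) — Milnor, *Introduction to Algebraic K-Theory*, §2 Thms. 2.1, 2.3,
  from `Literature.RingTheory.KTheory.milnor_patching`;
* **if `B₁ / A₁` and `B₂ / A₂` are finite étale then `B / A` is finite étale** (`etale_patchAlgebra`):
  `B` is flat and finitely presented (finite projective), and unramified because
  `Aᵢ ⊗_A Ω[B/A] ≅ Ω[Bᵢ/Aᵢ] = 0` (Mathlib `KaehlerDifferential.tensorKaehlerEquivBase` for the two
  pushout squares) while a Milnor square DETECTS finitely generated modules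
  (`MilnorSquare.subsingleton_of_subsingleton_tensor`: `A₁ ⊗ N = 0 = A₂ ⊗ N ⇒ N = 0`, proved
  prime-free: `A → A₂` is onto with kernel `I`, Nakayama gives `(1 + i) N = 0` with `i ∈ I`, and
  multiplication by `i` on `N` factors through `A₁ ⊗_A N` via the `A`-linear "multiplication by `i`"
  `μᵢ : A₁ → A`, `MilnorSquare.mulBack`); flat + unramified + finitely presented ⇒ étale
  (Mathlib `Algebra.Etale.of_formallyUnramified_of_flat`, Stacks 08WD).

This is the affine algebra behind "finite étale covers glue along a conductor square"
(descent of finite étale covers along the normalisation of a reduced variety, used for Riemann's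
existence theorem SGA1 XII 5.1 in place of SGA1 IX 4.7). Everything is proved; no named facts.

## References

* [Milnor1972] J. Milnor, *Introduction to Algebraic K-Theory*, Ann. of Math. Studies 72 (1971), §2
  Thms. 2.1–2.3 (p. 20).
* [StacksProject] The Stacks Project, Tag 08WD (flat + unramified + lfp ⇔ étale), Tag 00UM.
* [SGA1] A. Grothendieck, SGA 1, Exp. IX 4.7 (finite surjective morphisms are of effective descent
  for finite étale covers) — the statement this algebra replaces in the tree's use.
-/

noncomputable section

namespace Literature.RingTheory.Etale

open TensorProduct Literature.RingTheory.KTheory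

variable {A A₁ A₂ A' : Type*} [CommRing A] [CommRing A₁] [CommRing A₂] [CommRing A']
  [Algebra A A₁] [Algebra A A₂] [Algebra A₁ A'] [Algebra A₂ A']

/-! ### Consequences of the Milnor square axioms -/

namespace MilnorSquare

/-- In a Milnor square (with `A₁ → A'` surjective) the other map `A → A₂` is surjective. [folklore] -/
theorem surjective₂ (H : IsMilnorSquare A A₁ A₂ A') : Function.Surjective (algebraMap A A₂) := by
  intro x₂
  obtain ⟨x₁, hx₁⟩ := H.surjective (algebraMap A₂ A' x₂)
  obtain ⟨a, -, ha⟩ := H.exists_eq x₁ x₂ hx₁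
  exact ⟨a, ha⟩

variable [Algebra A A'] [IsScalarTower A A₁ A'] [IsScalarTower A A₂ A']

/-- For `i ∈ ker (A → A₂)` and `x₁ ∈ A₁`, the pair `(i x₁, 0)` is compatible. [folklore] -/
theorem compatible_mul (i : A) (hi : algebraMap A A₂ i = 0) (x₁ : A₁) :
    algebraMap A₁ A' (algebraMap A A₁ i * x₁) = algebraMap A₂ A' 0 := by
  rw [map_mul, ← IsScalarTower.algebraMap_apply, IsScalarTower.algebraMap_apply A A₂ A', hi,
    map_zero, zero_mul]

/-- **Multiplication by `i ∈ ker (A → A₂)` lands in `A`**: the `A`-linear map `μᵢ : A₁ → A` with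
`μᵢ(x₁) = ` the unique `a` with `(a, a) = (i x₁, 0)`. [folklore] -/
def mulBack (H : IsMilnorSquare A A₁ A₂ A') (i : A) (hi : algebraMap A A₂ i = 0) : A₁ →ₗ[A] A where
  toFun x₁ := Classical.choose (H.exists_eq _ _ (compatible_mul i hi x₁))
  map_add' x y := by
    apply H.injective_inc
    obtain ⟨hx1, hx2⟩ := Classical.choose_spec (H.exists_eq _ _ (compatible_mul i hi x))
    obtain ⟨hy1, hy2⟩ := Classical.choose_spec (H.exists_eq _ _ (compatible_mul i hi y))
    obtain ⟨hxy1, hxy2⟩ := Classical.choose_spec (H.exists_eq _ _ (compatible_mul i hi (x + y)))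
    rw [IsMilnorSquare.inc_apply, IsMilnorSquare.inc_apply, map_add, map_add, hxy1, hxy2, hx1, hx2, hy1, hy2,
      mul_add, add_zero]
  map_smul' r x := by
    apply H.injective_inc
    obtain ⟨hx1, hx2⟩ := Classical.choose_spec (H.exists_eq _ _ (compatible_mul i hi x))
    obtain ⟨hrx1, hrx2⟩ := Classical.choose_spec (H.exists_eq _ _ (compatible_mul i hi (r • x)))
    rw [IsMilnorSquare.inc_apply, IsMilnorSquare.inc_apply, hrx1, hrx2, RingHom.id_apply, smul_eq_mul, map_mul,
      hx1, map_mul, hx2, mul_zero, Algebra.smul_def, mul_left_comm]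

/-- Defining property of `μᵢ`: `(μᵢ x₁ : A₁) = i x₁` and `(μᵢ x₁ : A₂) = 0`. [folklore] -/
theorem mulBack_spec (H : IsMilnorSquare A A₁ A₂ A') (i : A) (hi : algebraMap A A₂ i = 0) (x₁ : A₁) :
    algebraMap A A₁ (mulBack H i hi x₁) = algebraMap A A₁ i * x₁ ∧ algebraMap A A₂ (mulBack H i hi x₁) = 0 :=
  Classical.choose_spec (H.exists_eq _ _ (compatible_mul i hi x₁))

/-- `μᵢ (a) = i a` for `a ∈ A`. [folklore] -/
theorem mulBack_algebraMap (H : IsMilnorSquare A A₁ A₂ A') (i : A) (hi : algebraMap A A₂ i = 0) (a : A) :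
    mulBack H i hi (algebraMap A A₁ a) = i * a := by
  apply H.injective_inc
  obtain ⟨h1, h2⟩ := mulBack_spec H i hi (algebraMap A A₁ a)
  rw [IsMilnorSquare.inc_apply, IsMilnorSquare.inc_apply, h1, h2, map_mul, map_mul, hi, zero_mul]

/-- `μᵢ (1) = i`. [folklore] -/
@[simp] theorem mulBack_one (H : IsMilnorSquare A A₁ A₂ A') (i : A) (hi : algebraMap A A₂ i = 0) :
    mulBack H i hi 1 = i := by
  rw [← map_one (algebraMap A A₁), mulBack_algebraMap, mul_one]

/-- **A Milnor square detects modules**: a finitely generated `A`-module `N` with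
`A₁ ⊗_A N = 0` and `A₂ ⊗_A N = 0` is zero. (Prime-free proof: `A₂ = A/I`, so `N = I N` and by
Nakayama `(1 + i) N = 0` for some `i ∈ I`; multiplication by `i` factors through `A₁ ⊗_A N = 0`.)
[folklore] -/
theorem subsingleton_of_subsingleton_tensor (H : IsMilnorSquare A A₁ A₂ A') (N : Type*) [AddCommGroup N]
    [Module A N] [Module.Finite A N] [h₁ : Subsingleton (A₁ ⊗[A] N)] [h₂ : Subsingleton (A₂ ⊗[A] N)] :
    Subsingleton N := by
  -- `I = ker (A → A₂)`, `A₂ ≅ A / I`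
  set I : Ideal A := RingHom.ker (algebraMap A A₂) with hI
  let e : (A ⧸ I) ≃ₐ[A] A₂ := Ideal.quotientKerAlgEquivOfSurjective (f := Algebra.ofId A A₂) (surjective₂ H)
  -- `N / I N ≅ A₂ ⊗ N = 0`, so `N = I N`
  have htop : I • (⊤ : Submodule A N) = ⊤ := by
    have hs : Subsingleton (N ⧸ I • (⊤ : Submodule A N)) := by
      have e' : (A₂ ⊗[A] N) ≃ₗ[A] N ⧸ I • (⊤ : Submodule A N) :=
        (LinearEquiv.rTensor N e.symm.toLinearEquiv).trans (TensorProduct.quotTensorEquivQuotSMul N I)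
      exact e'.symm.subsingleton
    exact Submodule.Quotient.subsingleton_iff.mp hs
  -- Nakayama: `r N = 0` with `r - 1 ∈ I`
  obtain ⟨r, hr, hrN⟩ := Submodule.exists_sub_one_mem_and_smul_eq_zero_of_fg_of_le_smul I ⊤
    Module.Finite.fg_top (le_of_eq htop.symm)
  have hi : algebraMap A A₂ (r - 1) = 0 := hr
  -- multiplication by `i = r - 1` on `N` factors through `A₁ ⊗ N = 0`
  have hzero : ∀ n : N, (r - 1) • n = 0 := by
    intro n
    let Φ : N →ₗ[A] N := (TensorProduct.lid A N).toLinearMap ∘ₗ (mulBack H (r - 1) hi).rTensor N ∘ₗ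
      ((Algebra.linearMap A A₁).rTensor N) ∘ₗ (TensorProduct.lid A N).symm.toLinearMap
    have hΦ : Φ n = (r - 1) • n := by
      simp [Φ, LinearMap.rTensor_tmul]
    have hΦ0 : Φ n = 0 := by
      have h0 : ((Algebra.linearMap A A₁).rTensor N) ((TensorProduct.lid A N).symm n) = 0 :=
        Subsingleton.elim _ _
      simp only [Φ, LinearMap.coe_comp, LinearEquiv.coe_coe, Function.comp_apply, h0, map_zero]
    rw [← hΦ, hΦ0]
  refine ⟨fun x y ↦ ?_⟩
  have hx : x = 0 := by
    have h1 := hrN x trivial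
    have h2 := hzero x
    rw [sub_smul, one_smul, h1, zero_sub, neg_eq_zero] at h2
    exact h2
  have hy : y = 0 := by
    have h1 := hrN y trivial
    have h2 := hzero y
    rw [sub_smul, one_smul, h1, zero_sub, neg_eq_zero] at h2
    exact h2
  rw [hx, hy]

end MilnorSquare

/-! ### Patching algebras -/

section Patch

variable [Algebra A A'] [IsScalarTower A A₁ A'] [IsScalarTower A A₂ A']
variable {B₁ : Type*} [CommRing B₁] [Algebra A₁ B₁] [Algebra A B₁] [IsScalarTower A A₁ B₁]
variable {B₂ : Type*} [CommRing B₂] [Algebra A₂ B₂] [Algebra A B₂] [IsScalarTower A A₂ B₂]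

variable (A) in
/-- **The patched algebra** `B = B₁ ×_θ B₂ = {(b₁, b₂) | 1 ⊗ b₁ = θ (1 ⊗ b₂)}` of two algebras glued
along an `A'`-algebra isomorphism `θ : A' ⊗_{A₂} B₂ ≅ A' ⊗_{A₁} B₁`; its underlying module is Milnor's
`M(B₁, B₂, θ)`. [cite: Milnor1972, §2 Basic construction (p. 20)] -/
def patchAlgebra (θ : (A' ⊗[A₂] B₂) ≃ₐ[A'] (A' ⊗[A₁] B₁)) : Subalgebra A (B₁ × B₂) where
  carrier := {b | ((1 : A') ⊗ₜ[A₁] b.1 : A' ⊗[A₁] B₁) = θ ((1 : A') ⊗ₜ[A₂] b.2)}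
  mul_mem' {b c} hb hc := by
    change ((1 : A') ⊗ₜ[A₁] b.1 : A' ⊗[A₁] B₁) = θ ((1 : A') ⊗ₜ[A₂] b.2) at hb
    change ((1 : A') ⊗ₜ[A₁] c.1 : A' ⊗[A₁] B₁) = θ ((1 : A') ⊗ₜ[A₂] c.2) at hc
    change ((1 : A') ⊗ₜ[A₁] (b.1 * c.1) : A' ⊗[A₁] B₁) = θ ((1 : A') ⊗ₜ[A₂] (b.2 * c.2))
    rw [show ((1 : A') ⊗ₜ[A₁] (b.1 * c.1) : A' ⊗[A₁] B₁) = (1 ⊗ₜ b.1) * (1 ⊗ₜ c.1) by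
        rw [Algebra.TensorProduct.tmul_mul_tmul, one_mul],
      show ((1 : A') ⊗ₜ[A₂] (b.2 * c.2) : A' ⊗[A₂] B₂) = (1 ⊗ₜ b.2) * (1 ⊗ₜ c.2) by
        rw [Algebra.TensorProduct.tmul_mul_tmul, one_mul],
      map_mul, hb, hc]
  one_mem' := by
    change ((1 : A') ⊗ₜ[A₁] (1 : B₁) : A' ⊗[A₁] B₁) = θ ((1 : A') ⊗ₜ[A₂] (1 : B₂))
    rw [← Algebra.TensorProduct.one_def, ← Algebra.TensorProduct.one_def, map_one]
  add_mem' {b c} hb hc := by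
    simp only [Set.mem_setOf_eq, Prod.fst_add, Prod.snd_add, tmul_add, map_add] at hb hc ⊢
    rw [hb, hc]
  zero_mem' := by simp
  algebraMap_mem' a := by
    change ((1 : A') ⊗ₜ[A₁] (algebraMap A B₁ a) : A' ⊗[A₁] B₁) = θ ((1 : A') ⊗ₜ[A₂] (algebraMap A B₂ a))
    rw [Algebra.algebraMap_eq_smul_one, Algebra.algebraMap_eq_smul_one, ← smul_tmul, ← smul_tmul,
      ← smul_tmul', ← smul_tmul', ← Algebra.TensorProduct.one_def, ← Algebra.TensorProduct.one_def]
    change a • (1 : A' ⊗[A₁] B₁) = θ.toLinearMap (a • (1 : A' ⊗[A₂] B₂))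
    rw [LinearMap.map_smul_of_tower, AlgEquiv.toLinearMap_apply, map_one]

/-- Membership in the patched algebra. [folklore] -/
theorem mem_patchAlgebra {θ : (A' ⊗[A₂] B₂) ≃ₐ[A'] (A' ⊗[A₁] B₁)} {b : B₁ × B₂} :
    b ∈ patchAlgebra A θ ↔ ((1 : A') ⊗ₜ[A₁] b.1 : A' ⊗[A₁] B₁) = θ ((1 : A') ⊗ₜ[A₂] b.2) := Iff.rfl

/-- The underlying module of the patched algebra is Milnor's `M(B₁, B₂, θ)`. [folklore] -/
theorem patchAlgebra_toSubmodule (θ : (A' ⊗[A₂] B₂) ≃ₐ[A'] (A' ⊗[A₁] B₁)) :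
    Subalgebra.toSubmodule (patchAlgebra A θ) = patch A A₁ A₂ A' θ.toLinearEquiv :=
  SetLike.coe_injective rfl

variable (A) in
/-- The patched algebra as a module is Milnor's `M(B₁, B₂, θ)` (the identity map). [folklore] -/
def patchAlgebraEquivPatch (θ : (A' ⊗[A₂] B₂) ≃ₐ[A'] (A' ⊗[A₁] B₁)) :
    patchAlgebra A θ ≃ₗ[A] patch A A₁ A₂ A' θ.toLinearEquiv where
  toFun b := ⟨b.1, b.2⟩
  invFun p := ⟨p.1, p.2⟩
  map_add' _ _ := rfl
  map_smul' _ _ := rfl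
  left_inv _ := rfl
  right_inv _ := rfl

variable (A) in
/-- First projection `B → B₁`, an `A`-algebra map. [folklore] -/
def patchFstHom (θ : (A' ⊗[A₂] B₂) ≃ₐ[A'] (A' ⊗[A₁] B₁)) : patchAlgebra A θ →ₐ[A] B₁ :=
  (AlgHom.fst A B₁ B₂).comp (patchAlgebra A θ).val

variable (A) in
/-- Second projection `B → B₂`, an `A`-algebra map. [folklore] -/
def patchSndHom (θ : (A' ⊗[A₂] B₂) ≃ₐ[A'] (A' ⊗[A₁] B₁)) : patchAlgebra A θ →ₐ[A] B₂ :=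
  (AlgHom.snd A B₁ B₂).comp (patchAlgebra A θ).val

/-- Formula for `patchFstHom`. [folklore] -/
@[simp] theorem patchFstHom_apply (θ : (A' ⊗[A₂] B₂) ≃ₐ[A'] (A' ⊗[A₁] B₁)) (b : patchAlgebra A θ) :
    patchFstHom A θ b = (b : B₁ × B₂).1 := rfl

/-- Formula for `patchSndHom`. [folklore] -/
@[simp] theorem patchSndHom_apply (θ : (A' ⊗[A₂] B₂) ≃ₐ[A'] (A' ⊗[A₁] B₁)) (b : patchAlgebra A θ) :
    patchSndHom A θ b = (b : B₁ × B₂).2 := rfl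

/-- `B → B₁ → A' ⊗ B₁` equals `θ ∘ (B → B₂ → A' ⊗ B₂)`. [folklore] -/
theorem one_tmul_patchFstHom (θ : (A' ⊗[A₂] B₂) ≃ₐ[A'] (A' ⊗[A₁] B₁)) (b : patchAlgebra A θ) :
    ((1 : A') ⊗ₜ[A₁] patchFstHom A θ b : A' ⊗[A₁] B₁) = θ ((1 : A') ⊗ₜ[A₂] patchSndHom A θ b) := b.2

variable (H : IsMilnorSquare A A₁ A₂ A')
include H

/-- **Milnor's Thm. 2.1 for algebras**: the patch of finite projective algebras is a finite
`A`-module. [cite: Milnor1972, §2 Thm. 2.1 (p. 20)] -/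
theorem finite_patchAlgebra [Module.Finite A₁ B₁] [Module.Projective A₁ B₁] [Module.Finite A₂ B₂]
    [Module.Projective A₂ B₂] (θ : (A' ⊗[A₂] B₂) ≃ₐ[A'] (A' ⊗[A₁] B₁)) :
    Module.Finite A (patchAlgebra A θ) :=
  haveI := finite_patch (A := A) H θ.toLinearEquiv
  Module.Finite.equiv (patchAlgebraEquivPatch A θ).symm

/-- **Milnor's Thm. 2.1 for algebras**: the patch of finite projective algebras is a projective
`A`-module. [cite: Milnor1972, §2 Thm. 2.1 (p. 20)] -/
theorem projective_patchAlgebra [Module.Finite A₁ B₁] [Module.Projective A₁ B₁] [Module.Finite A₂ B₂]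
    [Module.Projective A₂ B₂] (θ : (A' ⊗[A₂] B₂) ≃ₐ[A'] (A' ⊗[A₁] B₁)) :
    Module.Projective A (patchAlgebra A θ) :=
  haveI := projective_patch (A := A) H θ.toLinearEquiv
  Module.Projective.of_equiv (patchAlgebraEquivPatch A θ).symm

/-- **Milnor's Thm. 2.3 for algebras**, first factor: `B₁` is the base change of `B` along
`A → A₁` (through `patchFstHom`). [cite: Milnor1972, §2 Thm. 2.3 (p. 20)] -/
theorem isBaseChange_patchFstHom [Module.Finite A₁ B₁] [Module.Projective A₁ B₁] [Module.Finite A₂ B₂]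
    [Module.Projective A₂ B₂] (θ : (A' ⊗[A₂] B₂) ≃ₐ[A'] (A' ⊗[A₁] B₁)) :
    IsBaseChange A₁ (patchFstHom A θ).toLinearMap := by
  refine isBaseChange_of_equiv_comm (isBaseChange_patchFst (A := A) H θ.toLinearEquiv)
    (patchAlgebraEquivPatch A θ).symm (LinearEquiv.refl A₁ B₁) ?_
  intro p
  rfl

/-- **Milnor's Thm. 2.3 for algebras**, second factor: `B₂` is the base change of `B` along
`A → A₂` (through `patchSndHom`). [cite: Milnor1972, §2 Thm. 2.3 (p. 20)] -/
theorem isBaseChange_patchSndHom [Module.Finite A₁ B₁] [Module.Projective A₁ B₁] [Module.Finite A₂ B₂]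
    [Module.Projective A₂ B₂] (θ : (A' ⊗[A₂] B₂) ≃ₐ[A'] (A' ⊗[A₁] B₁)) :
    IsBaseChange A₂ (patchSndHom A θ).toLinearMap := by
  refine isBaseChange_of_equiv_comm (isBaseChange_patchSnd (A := A) H θ.toLinearEquiv)
    (patchAlgebraEquivPatch A θ).symm (LinearEquiv.refl A₂ B₂) ?_
  intro p
  rfl

omit H in
/-- A finite étale algebra is finite projective as a module. [folklore] -/
theorem projective_of_etale (R S : Type*) [CommRing R] [CommRing S] [Algebra R S] [Algebra.Etale R S]
    [Module.Finite R S] : Module.Projective R S :=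
  haveI := Module.FinitePresentation.of_finite_of_finitePresentation R S
  Module.Flat.projective_of_finitePresentation

/-- **Finite étale algebras patch over a Milnor square**: if `B₁ / A₁` and `B₂ / A₂` are finite
étale and `θ : A' ⊗_{A₂} B₂ ≅ A' ⊗_{A₁} B₁` is an `A'`-algebra isomorphism, then the patched algebra
`B = B₁ ×_θ B₂` is finite étale over `A` (and `Aᵢ ⊗_A B ≅ Bᵢ`, `isBaseChange_patchFstHom/SndHom`).
Proof: `B` is finite projective by Milnor's theorem, hence flat and finitely presented; it is
unramified because `Aᵢ ⊗_A Ω[B/A] ≅ Ω[Bᵢ/Aᵢ] = 0` (base change of differentials along the pushout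
squares) and a Milnor square detects modules (`subsingleton_of_subsingleton_tensor`); flat +
unramified + finitely presented is étale (Stacks 08WD). [folklore] -/
theorem etale_patchAlgebra [Algebra.Etale A₁ B₁] [Module.Finite A₁ B₁] [Algebra.Etale A₂ B₂]
    [Module.Finite A₂ B₂] (θ : (A' ⊗[A₂] B₂) ≃ₐ[A'] (A' ⊗[A₁] B₁)) :
    Algebra.Etale A (patchAlgebra A θ) := by
  haveI := projective_of_etale A₁ B₁
  haveI := projective_of_etale A₂ B₂
  haveI := finite_patchAlgebra H θ
  haveI := projective_patchAlgebra H θ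
  haveI : Module.FinitePresentation A (patchAlgebra A θ) := Module.finitePresentation_of_projective A _
  haveI : Algebra.FinitePresentation A (patchAlgebra A θ) := inferInstance
  -- the two pushout squares
  letI alg₁ : Algebra (patchAlgebra A θ) B₁ := (patchFstHom A θ).toRingHom.toAlgebra
  haveI : IsScalarTower A (patchAlgebra A θ) B₁ := IsScalarTower.of_algebraMap_eq (fun a ↦
    ((patchFstHom A θ).commutes a).symm)
  haveI hpo₁ : Algebra.IsPushout A A₁ (patchAlgebra A θ) B₁ := by
    refine ⟨?_⟩
    convert isBaseChange_patchFstHom H θ using 1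
    exact LinearMap.ext fun _ ↦ rfl
  letI alg₂ : Algebra (patchAlgebra A θ) B₂ := (patchSndHom A θ).toRingHom.toAlgebra
  haveI : IsScalarTower A (patchAlgebra A θ) B₂ := IsScalarTower.of_algebraMap_eq (fun a ↦
    ((patchSndHom A θ).commutes a).symm)
  haveI hpo₂ : Algebra.IsPushout A A₂ (patchAlgebra A θ) B₂ := by
    refine ⟨?_⟩
    convert isBaseChange_patchSndHom H θ using 1
    exact LinearMap.ext fun _ ↦ rfl
  -- differentials vanish after both base changes
  haveI : Subsingleton (A₁ ⊗[A] Ω[patchAlgebra A θ⁄A]) :=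
    (KaehlerDifferential.tensorKaehlerEquivBase A A₁ (patchAlgebra A θ) B₁).toEquiv.subsingleton
  haveI : Subsingleton (A₂ ⊗[A] Ω[patchAlgebra A θ⁄A]) :=
    (KaehlerDifferential.tensorKaehlerEquivBase A A₂ (patchAlgebra A θ) B₂).toEquiv.subsingleton
  haveI : Module.Finite A Ω[patchAlgebra A θ⁄A] :=
    Module.Finite.trans (patchAlgebra A θ) Ω[patchAlgebra A θ⁄A]
  haveI : Subsingleton Ω[patchAlgebra A θ⁄A] :=
    MilnorSquare.subsingleton_of_subsingleton_tensor H Ω[patchAlgebra A θ⁄A]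
  haveI : Algebra.FormallyUnramified A (patchAlgebra A θ) := ⟨inferInstance⟩
  exact Algebra.Etale.of_formallyUnramified_of_flat

end Patch

end Literature.RingTheory.Etale

end
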